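import Literature.NumberTheory.EllipticCurves.ExceptionalPrimesDensity
import Literature.NumberTheory.EllipticCurves.RealPeriod
import Summits.BirchSwinnertonDyer.BSDPercentage.Runbook.HeightDensitySanity
import HarnessLib

/-!
# Runbook sanity lemmas (2) — BSD-percentage cell (`pub-bsdpct`), REVIEW-RUNBOOK §2 definition cards

Computed values and hold/fail instances for Duke's height `dukeHeight`, Duke's family `dukeFamily X`,
exceptional primes `IsExceptionalPrime`, and the real two-torsion set `twoTorsionSet` (definitions under the
headline theorem `heightDensityGE_rankLeOne_and_fullBSDOffSgoPrime_cRank_of_sieve`).  Companion of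
`HeightDensitySanity.lean` (p202179).  Generated for `harness/kit/review_runbook.py` (ops-runbook seat).
-/

namespace Summit.BirchSwinnertonDyer.BSDPercentage.Runbook

open Literature.NumberTheory.EllipticCurves

/-- (b) computed value: Duke's height of `y² = x³ + 1` is `max(0, 1) = 1`. [folklore] -/
theorem dukeHeight_zero_one : dukeHeight (0, 1) = 1 := by
  simp [dukeHeight]

/-- (b) computed value: Duke's height of `y² = x³ − 2x + 3` is `max(|−2|³, 3²) = 9`. [folklore] -/
theorem dukeHeight_neg_two_three : dukeHeight (-2, 3) = 9 := by
  simp [dukeHeight]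

/-- (b) holds-instance: `y² = x³ + 1` lies in Duke's family `𝒞(1)` (height `1 ≤ 1⁶`, twelfth-power free, non-singular). [folklore] -/
theorem zero_one_mem_dukeFamily_one : ((0 : ℤ), (1 : ℤ)) ∈ dukeFamily 1 := by
  rw [mem_dukeFamily_iff]
  exact ⟨isInHeightFamily_zero_one, by simp [dukeHeight]⟩

/-- (b) fails-instance: the singular pair `(0, 0)` (`4·0³ + 27·0² = 0`) is in no `𝒞(X)`. [folklore] -/
theorem zero_zero_not_mem_dukeFamily (X : ℕ) : ((0 : ℤ), (0 : ℤ)) ∉ dukeFamily X := by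
  rw [mem_dukeFamily_iff]
  exact fun h => not_isInHeightFamily_zero_zero h.1

/-- (b) fails-instance: a non-prime is never an exceptional prime (`IsExceptionalPrime` requires `N.Prime`). [folklore] -/
theorem not_isExceptionalPrime_of_not_prime (W : WeierstrassCurve ℚ) {N : ℕ} (hN : ¬ N.Prime) :
    ¬ IsExceptionalPrime W N :=
  fun h => hN h.1

/-- (b) in particular `4` is not an exceptional prime of any curve. [folklore] -/
theorem not_isExceptionalPrime_four (W : WeierstrassCurve ℚ) : ¬ IsExceptionalPrime W 4 :=
  not_isExceptionalPrime_of_not_prime W (by decide)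

/-- (b) holds-instance: for `y² = x³ − x`, `x = 2` is in the two-torsion set (`ψ(2) = 24 > 0`). [folklore] -/
theorem two_mem_twoTorsionSet : (2 : ℝ) ∈ WeierstrassCurve.twoTorsionSet ⟨0, 0, 0, -1, 0⟩ := by
  simp [WeierstrassCurve.twoTorsionSet, WeierstrassCurve.twoTorsionPolynomial, Cubic.toPoly,
    WeierstrassCurve.b₂, WeierstrassCurve.b₄, WeierstrassCurve.b₆]
  norm_num

/-- (b) fails-instance: for `y² = x³ − x`, `x = 1/2` is not (`ψ(1/2) = −3/2 < 0`: no real point with this abscissa). [folklore] -/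
theorem half_not_mem_twoTorsionSet : (1 / 2 : ℝ) ∉ WeierstrassCurve.twoTorsionSet ⟨0, 0, 0, -1, 0⟩ := by
  simp [WeierstrassCurve.twoTorsionSet, WeierstrassCurve.twoTorsionPolynomial, Cubic.toPoly,
    WeierstrassCurve.b₂, WeierstrassCurve.b₄, WeierstrassCurve.b₆]
  norm_num

end Summit.BirchSwinnertonDyer.BSDPercentage.Runbook
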